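import Summits.ABC.IUTFork.Repair.RHLinearReachLawMixed
import Summits.ABC.IUTFork.Repair.RH2SigmaHull
import HarnessLib

/-!
# D-0079 RESCUE sub-cell R-H — `RHLinearReachLawMixedVsSlotReach`: ROW 15's slot-reach window IMPLIES ROW 20′'s mixed reach cell
# (Σ₁₅ ⊆ Σ₂₀′ in the kernel: the tuple reach cell is the head of the hull-reach family)

PROOF-ONLY file (0 definitions, 0 `Prop` facts; abc-iut cell, rung LADDER-ABC:A2.RESCUE.H; seat abc-iut-rh-typ-7 gen 5, row-20 lineage). TAKES NO
SIDE on [IUTchIII] Cor. 3.12 or on any author; nothing here asserts abc proved or refuted; both candidates (`RHSlotReach.SlotReachWindow`, row 15,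
abc-iut-lens-wuc-1; `RH.LinearReachLaw.HStarReachMix`, row 20′) are claim-tagged HYPOTHESES, and this file proves an implication between them.

WHY. The round-2 board lists the hull-reach family as «15 ⊋ 8, 16, 18; + 20» with the BAR (p468542 `RHLevelMoverTight`: pure-tensor mover reach =
level reach EXACTLY). Row 20′'s mixed cell IS «integer level weights exist on the summand» (p476752 header), i.e. the exact ceiling of the method; row
15's window chooses the levels SLOT BY SLOT (`⌊(m_Θ − n₀(w))/e_w⌋` at the last slot, `−⌈n₀(x_a)/e_{x_a}⌉` at each donor) instead of pooling them.
This file records the resulting nesting as kernel arithmetic and at the genuine bed: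

* §V1 `mixedReachCell_of_slotClause` — pure arithmetic: if the per-slot data satisfy `n₀ ≤ c` (inner certificate below THE inner conductor) and
  `λ ≤ −B/e` (outer certificate below THE outer order) at the TRUE ramification indices, then row 15's real clause at `m_Θ = j²·m_q` implies the
  rational mixed cell `MixedReachCell ((c−1)/e) (B/e) j (m_q/e_last)` with total level `K = ⌊(j²m_q − n₀(w))/e_w⌋ − Σ_a ⌈n₀(x_a)/e_{x_a}⌉`.
* §V2 certificates vs THE lattice integers at a place: `natCast_le_of_isInnerConductor_of_sharp` (`∃ u ∉ log_p𝒪^×, ‖u‖ ≤ p^{−(n₀−1)/e}` ⟹ `n₀ ≤ c`)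
  and `le_neg_div_of_isOuterOrder_of_rad` (`∃ z ∈ log_p𝒪^×, p^λ ≤ ‖z‖` ⟹ `λ ≤ −B/e`).
* §V3 at the genuine bed: `hStarReachMix_pilotDataOfK_of_slotReachWindowK` — under EXACTLY the dictionary binders `hn₀` / `hlam` / `hmq` of the
  row-15 door of record `RH2SigmaHull.pilotKummerCompatHull_ofShells_pilotDataOfK_of_slotReachWindowK` (p-landed, abc-iut-rh2-q2-hull), row 15's
  `SlotReachWindowK D ramIdx n₀ λ (j²·m_q) m_q` implies `HStarReachMix (pilotDataOfK D K)`. So every datum in Σ₁₅ (certified register) is in Σ₂₀′, and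
  row 15's hSHw door FACTORS through row 20′'s (`RHLinearReachLawMixedDoor.pilotKummerCompatHull_ofShells_pilotDataOfK_of_hStarReachMix`, p477348).
[cite: Mochizuki2012, IUTchI Ex. 3.2 (iv) p. 71; IUTchIII Thm. 3.11 (i) (Ind2) p. 154] [cite: DupuyHilado2025, §3.9, §4.9] [cite: NeukirchANT1999, Ch. II (5.5)]
[claim: Mochizuki2012, status: disputed] for every IUT sentence quoted. 0 sorry; standard axioms.
-/

noncomputable section

open Set Metric Function NumberField IsDedekindDomain
open scoped Pointwise

namespace Summit.ABC.IUTFork.Repair.RH.LinearReachLaw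

open Literature.IUT.LogVolume Literature.NumberTheory.GaloisRepresentations.Ultrametric

/-! ## §V1. Arithmetic: the slot-wise window implies the pooled (mixed) cell -/

/-- `e·⌈A/e⌉ ≤ A + e − 1` with `⌈A/e⌉ = −⌊−A/e⌋`, for `e ≥ 1` (Euclidean division). [folklore] -/
private theorem mul_ceilDiv_le {e : ℤ} (he : 1 ≤ e) (A : ℤ) : e * (-((-A) / e)) ≤ A + e - 1 := by
  have h := Int.mul_ediv_add_emod (-A) e
  have h1 := Int.emod_lt_of_pos (-A) (by omega : (0 : ℤ) < e)
  linarith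

/-- `x − (e − 1) ≤ e·⌊x/e⌋` for `e ≥ 1`. [folklore] -/
private theorem sub_le_mul_ediv {e : ℤ} (he : 1 ≤ e) (x : ℤ) : x - (e - 1) ≤ e * (x / e) := by
  have h := Int.mul_ediv_add_emod x e
  have h1 := Int.emod_lt_of_pos x (by omega : (0 : ℤ) < e)
  linarith

/-- **ROW 15's CLAUSE ⟹ ROW 20′'s MIXED CELL (pure arithmetic).** Slots `Fin (n+1)` (last slot `w = last n` at the bad place, donors `castSucc a`);
per slot the TRUE ramification index `e ≥ 1`, an inner certificate `n₀ ≤ c` below THE inner conductor `c`, and an outer certificate `λ ≤ −B/e` below THE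
outer order `B`; `q`-depth `m_q` at `w` and the realising Θ-depth `m_Θ = n²·m_q`. If row 15's real clause
`⌊(n²m_q − n₀(w))/e_w⌋ ≤ m_q/e_w + λ_w + Σ_a (λ_a + ⌈n₀(a)/e_a⌉)` holds, then the rational mixed cell `MixedReachCell ((c−1)/e) (B/e) n (m_q/e_w)` holds,
with total level `K = ⌊(n²m_q − n₀(w))/e_w⌋ − Σ_a ⌈n₀(a)/e_a⌉` (the slot-wise levels of row 15's movers, pooled). [folklore] -/
theorem mixedReachCell_of_slotClause {n : ℕ} (e n₀ c : Fin (n + 1) → ℕ) (B : Fin (n + 1) → ℤ) (lam : Fin (n + 1) → ℝ) (mq : ℤ)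
    (μ : ℚ) (hμ : (e (Fin.last n) : ℚ) * μ = mq)
    (he : ∀ a, 1 ≤ e a) (hn : ∀ a, n₀ a ≤ c a) (hlam : ∀ a, lam a ≤ -(B a : ℝ) / (e a : ℝ))
    (h15 : ((((n : ℤ) ^ 2 * mq - n₀ (Fin.last n)) / (e (Fin.last n) : ℤ) : ℤ) : ℝ)
        ≤ (mq : ℝ) / (e (Fin.last n) : ℝ) + lam (Fin.last n)
          + ∑ a : Fin n, (lam (Fin.castSucc a) + ((-((-(n₀ (Fin.castSucc a) : ℤ)) / (e (Fin.castSucc a) : ℤ)) : ℤ) : ℝ))) :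
    MixedReachCell (fun a => ((c a : ℚ) - 1) / (e a : ℚ)) (fun a => (B a : ℚ) / (e a : ℚ)) n μ := by
  -- notation: the floor at the last slot and the ceilings at the donors
  set w : Fin (n + 1) := Fin.last n with hw
  set L : ℤ := ((n : ℤ) ^ 2 * mq - n₀ w) / (e w : ℤ) with hL
  set C : Fin (n + 1) → ℤ := fun a => -((-(n₀ a : ℤ)) / (e a : ℤ)) with hC
  have heQ : ∀ a, (0 : ℚ) < (e a : ℚ) := fun a => by exact_mod_cast he a
  have hne : ∀ a, (e a : ℚ) ≠ 0 := fun a => (heQ a).ne'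
  have heR : ∀ a, (0 : ℝ) < (e a : ℝ) := fun a => by exact_mod_cast he a
  -- `μ = m_q / e_w`
  have hμ' : μ = (mq : ℚ) / (e w : ℚ) := by
    rw [← hμ]; exact (mul_div_cancel_left₀ μ (hne w)).symm
  subst hμ'
  -- Step 1: strip `λ` from the clause (`λ ≤ −B/e`), obtaining a RATIONAL inequality
  have h15Q : (L : ℚ) ≤ (mq : ℚ) / (e w : ℚ) - (B w : ℚ) / (e w : ℚ)
      + ∑ a : Fin n, (-(B (Fin.castSucc a) : ℚ) / (e (Fin.castSucc a) : ℚ) + (C (Fin.castSucc a) : ℚ)) := by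
    have hsum : ∑ a : Fin n, (lam (Fin.castSucc a) + ((C (Fin.castSucc a) : ℤ) : ℝ)) ≤
        ∑ a : Fin n, (-(B (Fin.castSucc a) : ℝ) / (e (Fin.castSucc a) : ℝ) + ((C (Fin.castSucc a) : ℤ) : ℝ)) :=
      Finset.sum_le_sum fun a _ => by linarith [hlam (Fin.castSucc a)]
    have hR : (L : ℝ) ≤ (mq : ℝ) / (e w : ℝ) - (B w : ℝ) / (e w : ℝ)
        + ∑ a : Fin n, (-(B (Fin.castSucc a) : ℝ) / (e (Fin.castSucc a) : ℝ) + ((C (Fin.castSucc a) : ℤ) : ℝ)) := by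
      have hw' := hlam w
      have : -(B w : ℝ) / (e w : ℝ) = -((B w : ℝ) / (e w : ℝ)) := by ring
      linarith [h15]
    have hcast : (((mq : ℚ) / (e w : ℚ) - (B w : ℚ) / (e w : ℚ)
        + ∑ a : Fin n, (-(B (Fin.castSucc a) : ℚ) / (e (Fin.castSucc a) : ℚ) + (C (Fin.castSucc a) : ℚ)) : ℚ) : ℝ)
        = (mq : ℝ) / (e w : ℝ) - (B w : ℝ) / (e w : ℝ)
          + ∑ a : Fin n, (-(B (Fin.castSucc a) : ℝ) / (e (Fin.castSucc a) : ℝ) + ((C (Fin.castSucc a) : ℤ) : ℝ)) := by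
      push_cast; rfl
    have hL' : ((L : ℚ) : ℝ) = (L : ℝ) := by push_cast; rfl
    have key : ((L : ℚ) : ℝ) ≤ (((mq : ℚ) / (e w : ℚ) - (B w : ℚ) / (e w : ℚ)
        + ∑ a : Fin n, (-(B (Fin.castSucc a) : ℚ) / (e (Fin.castSucc a) : ℚ) + (C (Fin.castSucc a) : ℚ)) : ℚ) : ℝ) := by
      rw [hL', hcast]; exact hR
    exact (Rat.cast_le (K := ℝ)).1 key
  -- Step 2: the pooled level
  refine ⟨L - ∑ a : Fin n, C (Fin.castSucc a), ?_, ?_⟩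
  · -- first conjunct: `n²·μ ≤ K + Σ (1 + α)`
    rw [Fin.sum_univ_castSucc]
    -- last slot: `L + 1 + (c_w − 1)/e_w ≥ n²·m_q/e_w` (floor bound + `n₀ w ≤ c w`)
    have hlast : ((n : ℚ) ^ 2 * mq) / (e w : ℚ) ≤ (L : ℚ) + (1 + ((c w : ℚ) - 1) / (e w : ℚ)) := by
      have h1 : ((n : ℤ) ^ 2 * mq - n₀ w) - ((e w : ℤ) - 1) ≤ (e w : ℤ) * L := sub_le_mul_ediv (by exact_mod_cast he w) _
      have h1Q : (((n : ℚ) ^ 2 * mq - n₀ w) - ((e w : ℚ) - 1)) ≤ (e w : ℚ) * L := by exact_mod_cast h1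
      have h2 : (n₀ w : ℚ) ≤ c w := by exact_mod_cast hn w
      rw [div_le_iff₀ (heQ w)]
      have : ((L : ℚ) + (1 + ((c w : ℚ) - 1) / (e w : ℚ))) * (e w : ℚ) = (e w : ℚ) * L + (e w : ℚ) + (c w : ℚ) - 1 := by
        rw [add_mul, add_mul, div_mul_cancel₀ _ (hne w)]; ring
      rw [this]; linarith
    -- donors: `−C a + 1 + (c_a − 1)/e_a ≥ 0` (ceiling bound + `n₀ a ≤ c a`)
    have hdon : ∀ a : Fin n, (0 : ℚ) ≤ -(C (Fin.castSucc a) : ℚ) + (1 + ((c (Fin.castSucc a) : ℚ) - 1) / (e (Fin.castSucc a) : ℚ)) := by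
      intro a
      set b := Fin.castSucc a
      have h1 : (e b : ℤ) * C b ≤ (n₀ b : ℤ) + (e b : ℤ) - 1 := mul_ceilDiv_le (by exact_mod_cast he b) _
      have h1Q : (e b : ℚ) * (C b : ℚ) ≤ (n₀ b : ℚ) + (e b : ℚ) - 1 := by exact_mod_cast h1
      have h2 : (n₀ b : ℚ) ≤ c b := by exact_mod_cast hn b
      have : -(C b : ℚ) + (1 + ((c b : ℚ) - 1) / (e b : ℚ)) = (((e b : ℚ) + (c b : ℚ) - 1) - (e b : ℚ) * (C b : ℚ)) / (e b : ℚ) := by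
        rw [eq_div_iff (hne b), add_mul, add_mul, div_mul_cancel₀ _ (hne b)]; ring
      rw [this]
      exact div_nonneg (by linarith) (heQ b).le
    have hsum := Finset.sum_nonneg fun a (_ : a ∈ (Finset.univ : Finset (Fin n))) => hdon a
    have hsplit : ∑ a : Fin n, (-(C (Fin.castSucc a) : ℚ) + (1 + ((c (Fin.castSucc a) : ℚ) - 1) / (e (Fin.castSucc a) : ℚ)))
        = -(∑ a : Fin n, (C (Fin.castSucc a) : ℚ)) + ∑ a : Fin n, (1 + ((c (Fin.castSucc a) : ℚ) - 1) / (e (Fin.castSucc a) : ℚ)) := by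
      rw [Finset.sum_add_distrib, Finset.sum_neg_distrib]
    rw [hsplit] at hsum
    have hmul : (n : ℚ) ^ 2 * ((mq : ℚ) / (e (Fin.last n) : ℚ)) = ((n : ℚ) ^ 2 * mq) / (e w : ℚ) := by rw [hw]; ring
    rw [hmul]
    push_cast
    rw [← hw]
    linarith
  · -- second conjunct: `K + Σ β ≤ μ`
    rw [Fin.sum_univ_castSucc]
    have hsplit : ∑ a : Fin n, (-(B (Fin.castSucc a) : ℚ) / (e (Fin.castSucc a) : ℚ) + (C (Fin.castSucc a) : ℚ))
        = -(∑ a : Fin n, (B (Fin.castSucc a) : ℚ) / (e (Fin.castSucc a) : ℚ)) + ∑ a : Fin n, (C (Fin.castSucc a) : ℚ) := by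
      rw [Finset.sum_add_distrib, ← Finset.sum_neg_distrib]
      congr 1
      exact Finset.sum_congr rfl fun a _ => by ring
    rw [hsplit] at h15Q
    push_cast
    rw [← hw]
    linarith

/-! ## §V2. Certificates versus THE lattice integers at one place -/

section Lattice

variable (p : ℕ) [hp : Fact p.Prime] {K : Type*} [NontriviallyNormedField K] [instK : NormedAlgebra ℚ_[p] K] [IsUltrametricDist K]
  [ProperSpace K]

/-- **Inner certificate ⟹ `n₀ ≤ c`**: a NON-member of `log_p(𝒪_K^×)` of norm `≤ p^{−(n₀−1)/e}` forces `n₀ ≤ c` for THE inner conductor `c` (whose ball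
`{‖·‖ ≤ ‖ϖ‖^c} = {‖·‖ ≤ p^{−c/e}}` lies inside `log_p(𝒪_K^×)`). [cite: NeukirchANT1999, Ch. II (5.5)] -/
theorem natCast_le_of_isInnerConductor_of_sharp {ϖ : Kˣ} (hϖ : IsUniformizer ϖ) {c n₀ : ℕ} (hc : IsInnerConductor K ϖ c)
    (hsharp : ∃ u : K, ‖u‖ ≤ (p : ℝ) ^ (-(((n₀ : ℤ) - 1 : ℤ) : ℝ) / (absRamificationIdx p K : ℝ)) ∧ u ∉ (logUnits K : Set K)) :
    n₀ ≤ c := by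
  obtain ⟨u, hu, hu'⟩ := hsharp
  by_contra hlt
  push Not at hlt
  have hc1 : (c : ℤ) ≤ (n₀ : ℤ) - 1 := by omega
  have hp1 : (1 : ℝ) < p := by exact_mod_cast hp.out.one_lt
  have he0 : (0 : ℝ) < absRamificationIdx p K := by exact_mod_cast absRamificationIdx_pos p K
  have hnorm : ‖(ϖ : K)‖ ^ c = (p : ℝ) ^ (-(c : ℝ) / (absRamificationIdx p K : ℝ)) := by
    rw [norm_eq_rpow_of_isUniformizer p K hϖ, ← Real.rpow_natCast, ← Real.rpow_mul (by positivity)]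
    congr 1; ring
  have hle : (p : ℝ) ^ (-(((n₀ : ℤ) - 1 : ℤ) : ℝ) / (absRamificationIdx p K : ℝ)) ≤ ‖(ϖ : K)‖ ^ c := by
    rw [hnorm]
    apply Real.rpow_le_rpow_of_exponent_le hp1.le
    rw [div_le_div_iff_of_pos_right he0, neg_le_neg_iff]
    exact_mod_cast hc1
  exact hu' (hc.1 (mem_closedBall_zero_iff.2 (hu.trans hle)))

/-- **Outer certificate ⟹ `λ ≤ −B/e`**: a MEMBER of `log_p(𝒪_K^×)` of norm `≥ p^λ` forces `λ ≤ −B/e` for THE outer order `B`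
(`max ‖log_p(𝒪_K^×)‖ = ‖ϖ‖^B = p^{−B/e}`). [cite: NeukirchANT1999, Ch. II (5.5)] -/
theorem le_neg_div_of_isOuterOrder_of_rad {ϖ : Kˣ} (hϖ : IsUniformizer ϖ) {B : ℤ} (hB : IsOuterOrder K ϖ B) {lam : ℝ}
    (hrad : ∃ z ∈ (logUnits K : Set K), (p : ℝ) ^ lam ≤ ‖z‖) : lam ≤ -(B : ℝ) / (absRamificationIdx p K : ℝ) := by
  obtain ⟨z, hz, hzl⟩ := hrad
  have hp1 : (1 : ℝ) < p := by exact_mod_cast hp.out.one_lt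
  have he0 : (0 : ℝ) < absRamificationIdx p K := by exact_mod_cast absRamificationIdx_pos p K
  have h1 := hB.1 z hz
  have hnorm : ‖(ϖ : K)‖ ^ B = (p : ℝ) ^ (-(B : ℝ) / (absRamificationIdx p K : ℝ)) := by
    rw [norm_eq_rpow_of_isUniformizer p K hϖ, ← Real.rpow_intCast, ← Real.rpow_mul (by positivity)]
    congr 1; ring
  rw [hnorm] at h1
  exact (Real.rpow_le_rpow_left_iff hp1).1 (hzl.trans h1)

end Lattice

/-! ## §V3. At the genuine bed: row 15's window (door binders of record) ⟹ `HStarReachMix (pilotDataOfK D K)` -/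

section Genuine

open Thm311 Thm311.Real Cor312 Cor312.Setting Cor312Vol Cor312Prov Literature.IUT.LogThetaLattice Literature.IUT.HodgeTheaters
  Summit.ABC.IUTFork.Repair.RH.ShellCapacityPlus Summit.ABC.IUTFork.Repair.RHSlotReach Summit.ABC.IUTFork.Repair.RH2SigmaHull

variable {F K Fbar : Type} [Field F] [NumberField F] [Field K] [NumberField K] [Algebra F K] [Field Fbar]
  [Algebra F Fbar] [Algebra K Fbar] {E : WeierstrassCurve F} [E.IsElliptic] {l : ℕ} {Pb : BadPlacePredicates K}
  (D : InitialThetaData F K Fbar E l Pb)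
  (n₀ : ∀ pp : Nat.Primes, (thetaIndex (pilotDataOfK D K)).Fibre (.inr pp) → ℕ)
  (lam : ∀ pp : Nat.Primes, (thetaIndex (pilotDataOfK D K)).Fibre (.inr pp) → ℝ)
  (mq : ∀ pp : Nat.Primes, (thetaIndex (pilotDataOfK D K)).Fibre (.inr pp) → ℤ)

/-- **Σ₁₅ ⊆ Σ₂₀′ AT THE GENUINE BED.** Under EXACTLY the dictionary binders of the row-15 door of record
(`RH2SigmaHull.pilotKummerCompatHull_ofShells_pilotDataOfK_of_slotReachWindowK`: inner certificates `hn₀`, outer certificates `hlam`, integer Kummer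
orders `hmq : m_q(w) = P_q(w)` at the bad places), row 15's window `SlotReachWindowK D ramIdx n₀ λ (j²·m_q) m_q` IMPLIES row 20′'s tuple reach cell
`HStarReachMix (pilotDataOfK D K)`: at a summand `ev` with bad last slot `w`, apply the window at `(w, donors := ev ∘ castSucc)`, compare the certificates
with THE lattice integers of each slot (§V2), and pool the slot-wise levels (§V1). Hence row 15's hSHw door factors through row 20′'s
(`RHLinearReachLawMixedDoor.pilotKummerCompatHull_ofShells_pilotDataOfK_of_hStarReachMix`). Both rows are HYPOTHESES; this is an implication between them.
[cite: Mochizuki2012, IUTchI Ex. 3.2 (iv) p. 71; IUTchIII Thm. 3.11 (i) (Ind2) p. 154] [cite: NeukirchANT1999, Ch. II (5.5)] [claim: Mochizuki2012, status: disputed] -/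
theorem hStarReachMix_pilotDataOfK_of_slotReachWindowK
    (hn₀ : ∀ (pp : Nat.Primes) (x : (thetaIndex (pilotDataOfK D K)).Fibre (.inr pp)), haveI : Fact (pp : ℕ).Prime := ⟨pp.2⟩
      ∃ u : kOf (pilotDataOfK D K) pp.1 x,
        ‖u‖ ≤ (pp : ℝ) ^ (-(((n₀ pp x : ℤ) - 1 : ℤ) : ℝ) / (ramIdx K (placeOf (pilotDataOfK D K) pp.1 x) : ℝ)) ∧
          u ∉ (logUnits (kOf (pilotDataOfK D K) pp.1 x) : Set (kOf (pilotDataOfK D K) pp.1 x)))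
    (hlam : ∀ (pp : Nat.Primes) (x : (thetaIndex (pilotDataOfK D K)).Fibre (.inr pp)), haveI : Fact (pp : ℕ).Prime := ⟨pp.2⟩
      ∃ z ∈ (logUnits (kOf (pilotDataOfK D K) pp.1 x) : Set (kOf (pilotDataOfK D K) pp.1 x)), (pp : ℝ) ^ (lam pp x) ≤ ‖z‖)
    (hmq : ∀ (pp : Nat.Primes) (w : (thetaIndex (pilotDataOfK D K)).Fibre (.inr pp)), haveI : Fact (pp : ℕ).Prime := ⟨pp.2⟩
      placeOf (pilotDataOfK D K) pp.1 w ∈ (pilotDataOfK D K).S →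
        (mq pp w : ℝ) = (pilotDataOfK D K).qPilot (placeOf (pilotDataOfK D K) pp.1 w))
    (hH : SlotReachWindowK D (fun pp x => haveI : Fact (pp : ℕ).Prime := ⟨pp.2⟩; ramIdx K (placeOf (pilotDataOfK D K) pp.1 x)) n₀ lam
      (fun pp i w => ((((i : ℕ) : ℤ) + 1) ^ 2) * mq pp w) mq) :
    HStarReachMix (pilotDataOfK D K) := by
  intro pp i ev hw ϖ hϖ c B hc hB
  haveI : Fact (pp : ℕ).Prime := ⟨pp.2⟩
  -- row 15's clause at `(w := ev last, donors := ev ∘ castSucc)`, ramification dictionary = the true indices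
  have h15 := ((slotReachWindowK_iff D _ _ _ _ _).1 hH) pp i (ev (Fin.last _)) hw (fun a => ev (Fin.castSucc a))
  simp only [ramIdx_eq] at h15
  -- per-slot data at the TRUE ramification indices
  have habs : ∀ a, absRamificationIdx pp (kOf (pilotDataOfK D K) pp.1 (ev a)) =
      (placeOf (pilotDataOfK D K) pp.1 (ev a)).asIdeal.ramificationIdx ℤ :=
    fun a => absRamificationIdx_kOf (pilotDataOfK D K) pp (ev a)
  have he1 : ∀ a, 1 ≤ (placeOf (pilotDataOfK D K) pp.1 (ev a)).asIdeal.ramificationIdx ℤ :=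
    fun a => Ideal.ramificationIdx_pos _ _
  -- certificates vs THE integers (§V2), slot by slot
  have hnc : ∀ a, n₀ pp (ev a) ≤ c a := fun a => by
    refine natCast_le_of_isInnerConductor_of_sharp (pp : ℕ) (hϖ a) (hc a) ?_
    rw [habs a, ← ramIdx_eq K]
    exact hn₀ pp (ev a)
  have hlB : ∀ a, lam pp (ev a) ≤ -(B a : ℝ) / ((placeOf (pilotDataOfK D K) pp.1 (ev a)).asIdeal.ramificationIdx ℤ : ℝ) :=
    fun a => by
    have h := le_neg_div_of_isOuterOrder_of_rad (pp : ℕ) (hϖ a) (hB a) (hlam pp (ev a))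
    rwa [habs a] at h
  -- `2l·m_q(w) = ord_w(q)` from `m_q(w) = P_q(w) = ord_w(q)/(2l)`
  have hord : (2 * (l : ℤ) * mq pp (ev (Fin.last _)) : ℤ) =
      (pilotDataOfK D K).ordq (placeOf (pilotDataOfK D K) pp.1 (ev (Fin.last _))) := by
    have h := hmq pp (ev (Fin.last _)) hw
    rw [(pilotDataOfK D K).qPilot_apply_of_mem hw, pilotDataOfK_l] at h
    have hl0 : (l : ℝ) ≠ 0 := by exact_mod_cast (pilotDataOfK D K).l_prime.ne_zero
    have h' : (2 * (l : ℝ) * mq pp (ev (Fin.last _)) : ℝ) =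
        (pilotDataOfK D K).ordq (placeOf (pilotDataOfK D K) pp.1 (ev (Fin.last _))) := by
      rw [h]; field_simp
    exact_mod_cast h'
  -- `e_w · μ = m_q(w)` for the goal's depth `μ = ord_w(q)/(2l·e_w)`
  have hl0 : (l : ℚ) ≠ 0 := by exact_mod_cast (pilotDataOfK D K).l_prime.ne_zero
  have heQ : ((placeOf (pilotDataOfK D K) pp.1 (ev (Fin.last _))).asIdeal.ramificationIdx ℤ : ℚ) ≠ 0 := by
    have := he1 (Fin.last _); exact_mod_cast (by omega : (placeOf (pilotDataOfK D K) pp.1 (ev (Fin.last _))).asIdeal.ramificationIdx ℤ ≠ 0)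
  have hμ : ((placeOf (pilotDataOfK D K) pp.1 (ev (Fin.last _))).asIdeal.ramificationIdx ℤ : ℚ) *
      (((pilotDataOfK D K).ordq (placeOf (pilotDataOfK D K) pp.1 (ev (Fin.last _))) : ℚ) /
        (2 * (pilotDataOfK D K).l * ((placeOf (pilotDataOfK D K) pp.1 (ev (Fin.last _))).asIdeal.ramificationIdx ℤ : ℚ))) =
      (mq pp (ev (Fin.last _)) : ℚ) := by
    rw [← hord, pilotDataOfK_l]
    push_cast
    field_simp
  -- §V1 at these data
  exact mixedReachCell_of_slotClause (n := (i : ℕ) + 1)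
    (fun a => (placeOf (pilotDataOfK D K) pp.1 (ev a)).asIdeal.ramificationIdx ℤ) (fun a => n₀ pp (ev a)) c B
    (fun a => lam pp (ev a)) (mq pp (ev (Fin.last _))) _ hμ he1 hnc hlB (by push_cast at h15 ⊢; exact h15)

end Genuine

end Summit.ABC.IUTFork.Repair.RH.LinearReachLaw

end
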